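import Summits.BirchSwinnertonDyer.BirchSwinnertonDyer.Theses.UniversalToricDescent
import Summits.BirchSwinnertonDyer.BirchSwinnertonDyer.Theorems.UniversalToricDescentTwoSidedMuTransferHoward
import Summits.BirchSwinnertonDyer.Rank1Residual.X11b.AnticyclotomicModuleFinite
import Literature.NumberTheory.EllipticCurves.HeegnerModuleIndex
import Literature.NumberTheory.EllipticCurves.LambdaAdicSelmerDataProofs
import Literature.NumberTheory.EllipticCurves.IwasawaSelmerDualProofs
import Literature.NumberTheory.EllipticCurves.GreenbergSelmer
import Literature.NumberTheory.EllipticCurves.AnticyclotomicSignedHeegnerClasses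

/-!
# Birth skeleton — line `birth` (= `beta-road`, both buckets) on `UniversalToricDescent.TwinAlgMuZeroAtThree`
# (stmt-BirchSwinnertonDyer-24737, crux r205, R2 text) — LEAD bsd-wall-utd-p1 g21, owed BC3 certificate (pen pss3x g9)

The (β)-road of the crux-idea cards `local-indivisibility-road` (utd-idea g51, multiplicative bucket B) and
`height-two-newton-signed-beta` (g57, good-supersingular bucket C₀, signed), typed on TREE OBJECTS ONLY
(B: `LambdaAdicSelmerData`, `SelmerDualData`, `HeegnerFamily`, `heegnerModule`; C₀: `AcSigned.selmerLambdaAdic`,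
`AcSigned.X`, `IsSignedHeegnerClass`, `signedHeegnerCharIdeal` under the tree's `moduleOfGen` structures; both:
`XAc … 𝔭′ ∅ γ`, local module `U_𝔭 ≅ Λ` built into `loc : 𝔖 → Λ`), composed through the LANDED Λ-algebra of the
two-sided link `…Theorems.UniversalToricDescentTwoSidedMuTransfer[Howard|Package]` (p730564 ✓, p730950 ✓, p731400 ✓;
Castella 2017 JLMS App. A Lemmas A.2–A.4 / BCK21 Thm 4.1 in μ-currency; the two primed lemmas of §0 are VERBATIM
restatements of the Package file, kept until the farm serves its olean). `sorry` ONLY in `stub_*`; EVERY stub is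
arithmetic; the algebra between the stubs and R2 is closed in the tree.

Stubs (6 ≤ stubs_max 7):
* B: `stub_ptPackage` — PRINT-PORT L/XL (Λ-adic Poitou–Tate for Selmer structures = Mazur–Rubin 2004 Thm 2.3.4 /
  Howard 2004 Thm 2.1.11 in the limit [finite level: tree fact `poitouTate_selmerStructure_duality`]; Castella 2017
  App. A Lemma 2.3 / A.2; non-anomalous multiplicative 3; Kummer/localisation of the Λ-adic Heegner class with the
  Bertolini–Darmon norm relations at 3 ∣ N′): ∃ `κ∞ ∈ ℋ_∞(D,F)`, `loc : 𝔖 →ₗ Λ` with (i) `loc κ∞ ≠ 0 →`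
  [`X_{∅,0}` torsion ∧ `μ(X_{∅,0}) ≤ μ(X_tors) + 2·μ(Λ/loc 𝔖)`] and (ii) «∃ k, z_k locally 3-indivisible at 𝔭» → `loc κ∞ ∉ (3)`.
* B: `stub_howardTwoSidedAtThree` — K2, RESEARCH at `3 ∥ N′` (Howard Thm B printed `p ∤ N` good ordinary): VERBATIM
  g51's `HowardDivisibilityMultThree` body. HARDEST (with its signed twin).
* B: `stub_locNondivisible` — K1 (β), RESEARCH class-wide / DECIDABLE per instance: g51's `LocalIndivisibleLayer` body.
* C₀: `stub_signedPackage` — PRINT-PORT to `p = 3`, L/XL (Castella–Wan 2024 Prop 4.4/Def 4.5/Lemma 4.7 class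
  existence [Lemma 4.3 freeness printed `p > 3`], signed PT bookkeeping §6 (6.14)–(6.15), g57's ω-division bridge):
  ∃ signed class `z`, torsion-freeness, `loc : Sel_ε → Λ`, the same inequality for `X_ε`, bridge from signed layer
  indivisibility.
* C₀: `stub_signedHoward` — K2^±, RESEARCH at `p = 3`: VERBATIM the conclusion of the tree's
  `castellaWan2024_thmA5_signedSelmer_rank_one_dvd_sq` (printed `3 < p`, `N` squarefree) at `p = 3`, `ρ̄` onto.
* C₀: `stub_signedLocNondivisible` — K1^±, RESEARCH / per-instance: g57's `SignedLayerIndivisible` body for some sign.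
Composition `TwinAlgMuZeroAtThree_of : TwinAlgMuZeroAtThree` kernel-checked (bucket split; each branch ONE application
of `isTorsion_and_exists_generator_of_package`). This line does NOT pre-empt the (402) chain (cdisprove → cruxidea →
triage → plan): a planned line replaces or sits beside `birth`. BSD is proved for no curve by this file; 24737 OPEN.
-/

noncomputable section

open scoped Classical

set_option linter.dupNamespace false
set_option autoImplicit false

namespace Summit.BirchSwinnertonDyer.BirchSwinnertonDyer.Cruxes.TwinAlgMuZeroAtThree.Birth

open NumberField IsDedekindDomain Field WeierstrassCurve
open Literature.NumberTheory.EllipticCurves Literature.NumberTheory.EllipticCurves.GreenbergSelmer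
  Literature.NumberTheory.EllipticCurves.IwasawaAlgebra
open Summit.BirchSwinnertonDyer.Rank1Residual.X11b Summit.BirchSwinnertonDyer.Rank1Residual.X11b.AcSelmer
open Literature.NumberTheory.EllipticCurves.AcSigned (selmerLambdaAdic IsSignedHeegnerClass signedHeegnerCharIdeal PCond)
open Summit.BirchSwinnertonDyer.BirchSwinnertonDyer.Theorems.UniversalToricDescentTwoSidedMuTransfer
  Summit.BirchSwinnertonDyer.BirchSwinnertonDyer.Theorems.UniversalToricDescentAcDualMuZero

/-! ## 0. The landed algebra (two VERBATIM restatements of `…TwoSidedMuTransferPackage`, see docstrings) -/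

/-- ALGEBRA (landed as `…Theorems.UniversalToricDescentTwoSidedMuTransfer.isTorsion_quotient_span_of_finrank_eq_one`,
p731400; restated here only because the farm node had not yet built that module when this sketch was checked): in a
finitely generated torsion-free `Λ`-module of rank one, the quotient by any non-zero element is torsion. -/
theorem isTorsion_quotient_span_of_finrank_eq_one' {p : ℕ} [Fact p.Prime] {S : Type*} [AddCommGroup S]
    [Module (IwasawaAlgebra p) S] [Module.Finite (IwasawaAlgebra p) S]
    [NoZeroSMulDivisors (IwasawaAlgebra p) S] (h1 : Module.finrank (IwasawaAlgebra p) S = 1)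
    {κ : S} (hκ : κ ≠ 0) :
    Module.IsTorsion (IwasawaAlgebra p) (S ⧸ Submodule.span (IwasawaAlgebra p) {κ}) := by
  intro x
  induction x using Submodule.Quotient.induction_on with
  | H m =>
    have hdep : ¬ LinearIndependent (IwasawaAlgebra p) ![κ, m] := by
      intro hli
      have := hli.fintype_card_le_finrank
      rw [Fintype.card_fin, h1] at this
      omega
    rw [LinearIndependent.pair_iff] at hdep
    push Not at hdep
    obtain ⟨s, t, hst, hne⟩ := hdep
    have ht : t ≠ 0 := by
      intro ht
      rw [ht, zero_smul, add_zero] at hst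
      rcases smul_eq_zero.mp hst with hs | hκ0
      · exact hne hs ht
      · exact hκ hκ0
    refine ⟨⟨t, mem_nonZeroDivisors_of_ne_zero ht⟩, ?_⟩
    rw [Submonoid.mk_smul, ← Submodule.Quotient.mk_smul, Submodule.Quotient.mk_eq_zero,
      Submodule.mem_span_singleton]
    exact ⟨-s, by rw [neg_smul]; exact neg_eq_of_add_eq_zero_right hst⟩

/-- ALGEBRA (landed as `…TwoSidedMuTransfer.isTorsion_and_exists_generator_of_package`, p731400; restated for the same
reason): package inequality + K2 (char-ideal currency, any `ℋ ∋ κ`) + K1 (`loc κ ∉ (p)`) ⟹ the conclusion shape. -/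
theorem isTorsion_and_exists_generator_of_package' {p : ℕ} [Fact p.Prime] {S X X₀ : Type*}
    [AddCommGroup S] [Module (IwasawaAlgebra p) S] [Module.Finite (IwasawaAlgebra p) S]
    [NoZeroSMulDivisors (IwasawaAlgebra p) S]
    [AddCommGroup X] [Module (IwasawaAlgebra p) X] [Module.Finite (IwasawaAlgebra p) X]
    [AddCommGroup X₀] [Module (IwasawaAlgebra p) X₀] [Module.Finite (IwasawaAlgebra p) X₀]
    (h1 : Module.finrank (IwasawaAlgebra p) S = 1) (κ : S) (H : Submodule (IwasawaAlgebra p) S) (hκH : κ ∈ H)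
    (loc : S →ₗ[IwasawaAlgebra p] IwasawaAlgebra p)
    (hpkg : loc κ ≠ 0 → Module.IsTorsion (IwasawaAlgebra p) X₀ ∧
      muInvariant p X₀ ≤ muInvariant p (Submodule.torsion (IwasawaAlgebra p) X) +
        2 * muInvariant p (IwasawaAlgebra p ⧸ LinearMap.range loc))
    (hHoward : Module.charIdeal (IwasawaAlgebra p) (Submodule.torsion (IwasawaAlgebra p) X) ∣
      Module.charIdeal (IwasawaAlgebra p) (S ⧸ H) ^ 2)
    (hβ : loc κ ∉ augIdealP p) :
    Module.IsTorsion (IwasawaAlgebra p) X₀ ∧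
      ∃ g : UnrSeries p,
        (Module.charIdeal (IwasawaAlgebra p) X₀).map (PowerSeries.map (Halves.toUnr p)) = Ideal.span {g} ∧
          ∃ i : ℕ, ‖((PowerSeries.coeff i g : unrIntegers p) : ℂ_[p])‖ = 1 := by
  have hloc0 : loc κ ≠ 0 := fun h => hβ (h ▸ Submodule.zero_mem _)
  have hκ0 : κ ≠ 0 := fun h => hloc0 (by rw [h, map_zero])
  obtain ⟨hX₀, hle⟩ := hpkg hloc0
  have hSκ := isTorsion_quotient_span_of_finrank_eq_one' h1 hκ0
  have hinj : Function.Injective loc := injective_of_isTorsion_quotient loc κ hSκ hloc0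
  haveI : IsNoetherian (IwasawaAlgebra p) X := isNoetherian_of_isNoetherianRing_of_finite _ _
  haveI : Module.Finite (IwasawaAlgebra p) (Submodule.torsion (IwasawaAlgebra p) X) :=
    Module.Finite.iff_fg.mpr (IsNoetherian.noetherian _)
  have hleH : Submodule.span (IwasawaAlgebra p) {κ} ≤ H.comap LinearMap.id := by
    rw [Submodule.comap_id, Submodule.span_singleton_le_iff_mem]; exact hκH
  have hSH : Module.IsTorsion (IwasawaAlgebra p) (S ⧸ H) :=
    Literature.NumberTheory.EllipticCurves.isTorsion_of_surjective (Submodule.mapQ _ _ LinearMap.id hleH)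
      (fun y => by
        induction y using Submodule.Quotient.induction_on with
        | H s => exact ⟨Submodule.Quotient.mk s, by rw [Submodule.mapQ_apply, LinearMap.id_apply]⟩) hSκ
  have hHow1 := muInvariant_le_mul_of_charIdeal_dvd_pow
    (Submodule.torsion_isTorsion (R := IwasawaAlgebra p) (M := X)) hSH 2 hHoward
  have hHow2 := muInvariant_quotient_le_of_mem H hκH hSκ
  have hnot : ¬ ∃ v : IwasawaAlgebra p, loc κ = (p : IwasawaAlgebra p) • v := by
    rintro ⟨v, hv⟩
    apply hβ
    rw [augIdealP, Ideal.mem_span_singleton]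
    exact ⟨v, by rw [hv, smul_eq_mul, ← map_natCast (PowerSeries.C (R := ℤ_[p])) p]⟩
  obtain ⟨hTΛ, hμ0⟩ :=
    isTorsion_and_muInvariant_eq_zero_of_not_mem_smul (LinearEquiv.refl (IwasawaAlgebra p) _) (loc κ) hnot
  have hA4 := muInvariant_quotient_span_eq_add loc hinj κ hTΛ
  have hμ : muInvariant p X₀ = 0 := by omega
  exact ⟨hX₀, exists_map_charIdeal_eq_span_of_muInvariant_eq_zero X₀ hX₀ hμ⟩

/-! ## 1. The stubs -/

/-- **stub_ptPackage** (PRINT-PORT, L/XL). The arithmetic package of the two-sided link on bucket B: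
for `E′` très-ramifié multiplicative at 3 with `ρ̄` onto, `K` Heegner for `N′` with odd `d_K` and `3 = 𝔭𝔭′` split,
the Λ-adic Selmer datum `D` (`𝔖 = D.S`), the dual Selmer datum `X` (`X.X = X(E′/K_∞)`), a Heegner family `F`
with Manin constant prime to 3, and the rank data of K2: there are `κ∞ ∈ ℋ_∞ = heegnerModule D F` and a
Λ-linear `loc : 𝔖 → Λ` (= `loc_𝔭` followed by `H¹_Gr(K_𝔭, 𝐓^ac) ≅ Λ`) such that
(i) if `loc κ∞ ≠ 0` then `X_{∅,0} = XAc (E′/K) 3 κ 𝔭′ ∅ γ` is Λ-torsion and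
`μ(X_{∅,0}) ≤ μ(X_{Λ-tors}) + 2·μ(Λ/loc 𝔖)` (Castella App. A (A.5)–(A.7) + Lemma 2.3, through the landed
`isTorsion_and_muInvariant_le_twoSided`); (ii) «∃ k, z_k locally 3-indivisible at 𝔭» `→ loc κ∞ ∉ (3)` (g51's `LocalIndivisibleLayer` body inlined) (`κ∞` specialises to
`± z_k`, Bertolini–Darmon norm relations at `3 ∣ N′`; Kummer injectivity). -/
theorem stub_ptPackage :
    ∀ (W' : WeierstrassCurve ℚ) [W'.IsElliptic] [W'.IsGloballyMinimal] (N' : ℕ) [NeZero N']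
      (K : Type) [Field K] [NumberField K],
      Rank1Residual.Mult W' 3 → ¬ 3 ∣ padicValInt 3 W'.minimalDiscriminantInt →
      W'.HasSurjectiveModNGaloisRep 3 → W'.conductorNorm ℤ = N' → IsImaginaryQuadratic K →
      SatisfiesHeegnerHypothesis N' K → Odd (NumberField.discr K) →
      ∀ (κ : ZpExtension K 3), κ.IsAnticyclotomic →
      ∀ (γ : absoluteGaloisGroup K) [Fact (κ.IsTopGenerator γ)]
        (𝔭 : HeightOneSpectrum (𝓞 K)), ((3 : ℕ) : 𝓞 K) ∈ 𝔭.asIdeal →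
        𝔭.asIdeal.ramificationIdx (𝓞 ℚ) = 1 → 𝔭.asIdeal.inertiaDeg (𝓞 ℚ) = 1 →
      ∀ (𝔭' : HeightOneSpectrum (𝓞 K)), ((3 : ℕ) : 𝓞 K) ∈ 𝔭'.asIdeal → 𝔭' ≠ 𝔭 →
      ∀ (jbar : AlgebraicClosure K →+* ℂ) (D : (W'.baseChange K).LambdaAdicSelmerData κ γ)
        (F : HeegnerFamily N' W' K κ jbar) (X : (W'.baseChange K).SelmerDualData κ γ),
      ¬ (3 : ℤ) ∣ F.Dt.c →
      Module.Finite (IwasawaAlgebra 3) D.S → NoZeroSMulDivisors (IwasawaAlgebra 3) D.S →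
      Module.finrank (IwasawaAlgebra 3) D.S = 1 →
      Module.Finite (IwasawaAlgebra 3) X.X → Module.finrank (IwasawaAlgebra 3) X.X = 1 →
      ∃ (κinf : D.S) (loc : D.S →ₗ[IwasawaAlgebra 3] IwasawaAlgebra 3),
        κinf ∈ heegnerModule D F ∧
        (loc κinf ≠ 0 →
          Module.IsTorsion (IwasawaAlgebra 3) (XAc (W'.baseChange K) 3 κ 𝔭' ∅ γ) ∧
          muInvariant 3 (XAc (W'.baseChange K) 3 κ 𝔭' ∅ γ) ≤
            muInvariant 3 (Submodule.torsion (IwasawaAlgebra 3) X.X) +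
              2 * muInvariant 3 (IwasawaAlgebra 3 ⧸ LinearMap.range loc)) ∧
        ((∃ k : ℕ, ∀ (Q : geomPoints (W'.baseChange K))
          (hQ : ∀ σ ∈ κ.layerSubgroup k ⊓ decomp 𝔭, σ • ((3 : ℤ) • Q) = (3 : ℤ) • Q),
          (3 : ℤ) • Q = F.z k →
            (W'.baseChange K).kummerClassOver (κ.layerSubgroup k ⊓ decomp 𝔭) 3 Q hQ ≠ 0) →
          loc κinf ∉ augIdealP 3) := by
  sorry

/-- **stub_howardTwoSidedAtThree** (K2, RESEARCH — Howard 2004 Thm. B at `3 ∥ N′`, très ramifié, `ρ̄` onto; printed only for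
`p ∤ N` good ordinary with 3-adic surjectivity). VERBATIM the body of g51's `HowardDivisibilityMultThree` with the
top generator carried as a `Fact` (as in R2). -/
theorem stub_howardTwoSidedAtThree :
    ∀ (W' : WeierstrassCurve ℚ) [W'.IsElliptic] [W'.IsGloballyMinimal] (N' : ℕ) [NeZero N']
      (K : Type) [Field K] [NumberField K],
      Rank1Residual.Mult W' 3 → ¬ 3 ∣ padicValInt 3 W'.minimalDiscriminantInt →
      W'.HasSurjectiveModNGaloisRep 3 → W'.conductorNorm ℤ = N' → IsImaginaryQuadratic K →
      SatisfiesHeegnerHypothesis N' K → Odd (NumberField.discr K) →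
      ∀ (κ : ZpExtension K 3), κ.IsAnticyclotomic →
      ∀ (γ : absoluteGaloisGroup K) [Fact (κ.IsTopGenerator γ)]
        (jbar : AlgebraicClosure K →+* ℂ) (D : (W'.baseChange K).LambdaAdicSelmerData κ γ)
        (F : HeegnerFamily N' W' K κ jbar) (X : (W'.baseChange K).SelmerDualData κ γ),
      (Module.Finite (IwasawaAlgebra 3) D.S ∧ NoZeroSMulDivisors (IwasawaAlgebra 3) D.S ∧
          Module.finrank (IwasawaAlgebra 3) D.S = 1) ∧
        (Module.Finite (IwasawaAlgebra 3) X.X ∧ Module.finrank (IwasawaAlgebra 3) X.X = 1 ∧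
          Module.charIdeal (IwasawaAlgebra 3) (Submodule.torsion (IwasawaAlgebra 3) X.X) ∣
            heegnerCharIdeal D F ^ 2) := by
  sorry

/-- **stub_locNondivisible** (K1 = (β), RESEARCH class-wide; each instance `(E′, K, k)` is a finite
computation): on bucket B there is a Heegner family along the anticyclotomic tower with Manin constant prime to 3
one of whose layer points is locally 3-indivisible at the degree-one prime `𝔭` (g51's `LocalIndivisibleLayer` body, inlined: non-zero mod-3 Kummer class on `Γ_{K_k} ∩ D_𝔭`). -/
theorem stub_locNondivisible :
    ∀ (W' : WeierstrassCurve ℚ) [W'.IsElliptic] [W'.IsGloballyMinimal] (N' : ℕ) [NeZero N']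
      (K : Type) [Field K] [NumberField K],
      Rank1Residual.Mult W' 3 → ¬ 3 ∣ padicValInt 3 W'.minimalDiscriminantInt →
      W'.HasSurjectiveModNGaloisRep 3 → W'.conductorNorm ℤ = N' → IsImaginaryQuadratic K →
      SatisfiesHeegnerHypothesis N' K → Odd (NumberField.discr K) →
      ∀ (κ : ZpExtension K 3), κ.IsAnticyclotomic →
      ∀ (𝔭 : HeightOneSpectrum (𝓞 K)), ((3 : ℕ) : 𝓞 K) ∈ 𝔭.asIdeal →
        𝔭.asIdeal.ramificationIdx (𝓞 ℚ) = 1 → 𝔭.asIdeal.inertiaDeg (𝓞 ℚ) = 1 →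
      ∃ (jbar : AlgebraicClosure K →+* ℂ) (F : HeegnerFamily N' W' K κ jbar),
        ¬ (3 : ℤ) ∣ F.Dt.c ∧
        (∃ k : ℕ, ∀ (Q : geomPoints (W'.baseChange K))
          (hQ : ∀ σ ∈ κ.layerSubgroup k ⊓ decomp 𝔭, σ • ((3 : ℤ) • Q) = (3 : ℤ) • Q),
          (3 : ℤ) • Q = F.z k →
            (W'.baseChange K).kummerClassOver (κ.layerSubgroup k ⊓ decomp 𝔭) 3 Q hQ ≠ 0) := by
  sorry

/-- **stub_signedPackage** (PRINT-PORT to `p = 3`, L/XL; bucket C₀). Castella–Wan 2024 Prop. 4.4 / Def. 4.5 /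
Lemma 4.7 (existence of the signed class `z^ε_∞ ∈ Sel_ε(K, 𝐓^ac)`, Lemma 4.3 freeness — printed `p > 3`), the signed
two-sided Poitou–Tate bookkeeping (§6, (6.14)–(6.15): `X^{rel,str}` versus `X_ε`; the tree's `X^{𝓛,Σ}` carriers) in
μ-currency through the landed `isTorsion_and_muInvariant_le_twoSided`, and the ω-division bridge from signed layer
indivisibility (utd-idea g57 K2″, `OmegaDivision.exists_eq_smul_add_smul`) — all with `H¹_ε(K_𝔭, 𝐓^ac) ≅ Λ`
built in (`loc : Sel_ε → Λ`). Statement under the tree's `moduleOfGen` structures (activated by `letI`). -/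
theorem stub_signedPackage :
    ∀ (W' : WeierstrassCurve ℚ) [W'.IsElliptic] [W'.IsGloballyMinimal] (N' : ℕ) [NeZero N']
      (K : Type) [Field K] [NumberField K],
      Rank1Residual.GoodSS W' 3 → W'.frobeniusTrace 3 = 0 →
      W'.HasSurjectiveModNGaloisRep 3 → W'.conductorNorm ℤ = N' → IsImaginaryQuadratic K →
      SatisfiesHeegnerHypothesis N' K → Odd (NumberField.discr K) →
      ∀ (κ : ZpExtension K 3), κ.IsAnticyclotomic →
      ∀ (γ : absoluteGaloisGroup K) [hγ : Fact (κ.IsTopGenerator γ)]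
        (𝔭 : HeightOneSpectrum (𝓞 K)), ((3 : ℕ) : 𝓞 K) ∈ 𝔭.asIdeal →
        𝔭.asIdeal.ramificationIdx (𝓞 ℚ) = 1 → 𝔭.asIdeal.inertiaDeg (𝓞 ℚ) = 1 →
      ∀ (𝔭' : HeightOneSpectrum (𝓞 K)), ((3 : ℕ) : 𝓞 K) ∈ 𝔭'.asIdeal → 𝔭' ≠ 𝔭 →
      ∀ (jbar : AlgebraicClosure K →+* ℂ) (F : HeegnerFamily N' W' K κ jbar) (ε : ℤˣ),
      ¬ (3 : ℤ) ∣ F.Dt.c → F.IsTraceCoherentApZero →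
      ∃ z : selmerLambdaAdic (W'.baseChange K) 3 κ γ (fun _ ↦ .sgn ε),
        IsSignedHeegnerClass 3 κ γ F ε z.1 ∧
        letI := selmerLambdaAdic.moduleOfGen (W'.baseChange K) 3 κ γ hγ.out (fun _ ↦ PCond.sgn ε)
        letI := AcSigned.X.moduleOfGen (W'.baseChange K) 3 κ ∅ (fun _ ↦ PCond.sgn ε) hγ.out
        NoZeroSMulDivisors (IwasawaAlgebra 3) (selmerLambdaAdic (W'.baseChange K) 3 κ γ (fun _ ↦ .sgn ε)) ∧
        ∃ loc : selmerLambdaAdic (W'.baseChange K) 3 κ γ (fun _ ↦ .sgn ε) →ₗ[IwasawaAlgebra 3] IwasawaAlgebra 3,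
          (Module.Finite (IwasawaAlgebra 3) (selmerLambdaAdic (W'.baseChange K) 3 κ γ (fun _ ↦ .sgn ε)) →
            Module.finrank (IwasawaAlgebra 3) (selmerLambdaAdic (W'.baseChange K) 3 κ γ (fun _ ↦ .sgn ε)) = 1 →
            Module.Finite (IwasawaAlgebra 3) (AcSigned.X (W'.baseChange K) 3 κ ∅ (fun _ ↦ PCond.sgn ε)) →
            loc z ≠ 0 →
              Module.IsTorsion (IwasawaAlgebra 3) (XAc (W'.baseChange K) 3 κ 𝔭' ∅ γ) ∧
              muInvariant 3 (XAc (W'.baseChange K) 3 κ 𝔭' ∅ γ) ≤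
                muInvariant 3 (Submodule.torsion (IwasawaAlgebra 3)
                  (AcSigned.X (W'.baseChange K) 3 κ ∅ (fun _ ↦ PCond.sgn ε))) +
                  2 * muInvariant 3 (IwasawaAlgebra 3 ⧸ LinearMap.range loc)) ∧
          ((∀ k₀ : ℕ, ∃ k : ℕ, k₀ ≤ k ∧ (-1 : ℤˣ) ^ k = ε ∧ ∀ (Q : geomPoints (W'.baseChange K))
          (hQ : ∀ σ ∈ κ.layerSubgroup k ⊓ decomp 𝔭, σ • ((3 : ℤ) • Q) = (3 : ℤ) • Q),
          (3 : ℤ) • Q = F.z k →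
            (W'.baseChange K).kummerClassOver (κ.layerSubgroup k ⊓ decomp 𝔭) 3 Q hQ ≠ 0) →
            loc z ∉ augIdealP 3) := by
  sorry

/-- **stub_signedHoward** (K2^±, RESEARCH at `p = 3`): Castella–Wan 2024 Thm. A.5 (with Lemma 6.7 (1)) — the
signed Kolyvagin-system divisibility `char(X_{ε,tors}) ∣ char(Sel_ε(K, 𝐓^ac)/Λ^ac z^ε_∞)²` with both ranks one —
VERBATIM the conclusion of the tree's `castellaWan2024_thmA5_signedSelmer_rank_one_dvd_sq` (printed `3 < p`, `N`
squarefree) read at `p = 3`, `a₃ = 0`, `ρ̄` onto (no squarefree hypothesis: surjectivity is a binder here). -/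
theorem stub_signedHoward :
    ∀ (W' : WeierstrassCurve ℚ) [W'.IsElliptic] [W'.IsGloballyMinimal] (N' : ℕ) [NeZero N']
      (K : Type) [Field K] [NumberField K],
      Rank1Residual.GoodSS W' 3 → W'.frobeniusTrace 3 = 0 →
      W'.HasSurjectiveModNGaloisRep 3 → W'.conductorNorm ℤ = N' → IsImaginaryQuadratic K →
      SatisfiesHeegnerHypothesis N' K → Odd (NumberField.discr K) →
      ∀ (κ : ZpExtension K 3), κ.IsAnticyclotomic →
      ∀ (γ : absoluteGaloisGroup K) [hγ : Fact (κ.IsTopGenerator γ)]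
        (jbar : AlgebraicClosure K →+* ℂ) (F : HeegnerFamily N' W' K κ jbar), F.IsTraceCoherentApZero →
      ∀ (ε : ℤˣ) (z : selmerLambdaAdic (W'.baseChange K) 3 κ γ (fun _ ↦ .sgn ε)),
        IsSignedHeegnerClass 3 κ γ F ε z.1 →
        selmerLambdaAdic.HasRank (W'.baseChange K) 3 κ γ hγ.out (fun _ ↦ .sgn ε) 1 ∧
        AcSigned.X.HasRank (W'.baseChange K) 3 κ ∅ (fun _ ↦ .sgn ε) hγ.out 1 ∧
        AcSigned.X.torsionCharIdeal (W'.baseChange K) 3 κ ∅ (fun _ ↦ .sgn ε) hγ.out ∣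
          signedHeegnerCharIdeal hγ.out ε z ^ 2 := by
  sorry

/-- **stub_signedLocNondivisible** (K1^±, RESEARCH class-wide, DECIDABLE per instance): on bucket C₀ some
trace-coherent Heegner family with Manin constant prime to 3 has, for some sign `ε`, locally 3-indivisible layer
points at `𝔭` at infinitely many layers of parity `ε` — VERBATIM the body of utd-idea g57's `SignedLayerIndivisible`
(engine `height-two-newton-signed-beta`: integral signed Coleman map + Castella–Wan Thm 5.6 port + Hsieh Thm B). -/
theorem stub_signedLocNondivisible :
    ∀ (W' : WeierstrassCurve ℚ) [W'.IsElliptic] [W'.IsGloballyMinimal] (N' : ℕ) [NeZero N']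
      (K : Type) [Field K] [NumberField K],
      Rank1Residual.GoodSS W' 3 → W'.frobeniusTrace 3 = 0 →
      W'.HasSurjectiveModNGaloisRep 3 → W'.conductorNorm ℤ = N' → IsImaginaryQuadratic K →
      SatisfiesHeegnerHypothesis N' K → Odd (NumberField.discr K) →
      ∀ (κ : ZpExtension K 3), κ.IsAnticyclotomic →
      ∀ (𝔭 : HeightOneSpectrum (𝓞 K)), ((3 : ℕ) : 𝓞 K) ∈ 𝔭.asIdeal →
        𝔭.asIdeal.ramificationIdx (𝓞 ℚ) = 1 → 𝔭.asIdeal.inertiaDeg (𝓞 ℚ) = 1 →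
      ∃ (jbar : AlgebraicClosure K →+* ℂ) (F : HeegnerFamily N' W' K κ jbar) (ε : ℤˣ),
        ¬ (3 : ℤ) ∣ F.Dt.c ∧ F.IsTraceCoherentApZero ∧
        (∀ k₀ : ℕ, ∃ k : ℕ, k₀ ≤ k ∧ (-1 : ℤˣ) ^ k = ε ∧ ∀ (Q : geomPoints (W'.baseChange K))
          (hQ : ∀ σ ∈ κ.layerSubgroup k ⊓ decomp 𝔭, σ • ((3 : ℤ) • Q) = (3 : ℤ) • Q),
          (3 : ℤ) • Q = F.z k →
            (W'.baseChange K).kummerClassOver (κ.layerSubgroup k ⊓ decomp 𝔭) 3 Q hQ ≠ 0) := by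
  sorry

/-! ## 2. The composition (kernel-checked, no `sorry` below this line) -/

/-- Bucket B of R2 from the three B-stubs and the landed two-sided Λ-algebra. -/
theorem twinAlgMu_mult
    (W' : WeierstrassCurve ℚ) [W'.IsElliptic] [W'.IsGloballyMinimal] (N' : ℕ) [NeZero N']
    (K : Type) [Field K] [NumberField K]
    (hm : Rank1Residual.Mult W' 3) (htr : ¬ 3 ∣ padicValInt 3 W'.minimalDiscriminantInt)
    (hsurj : W'.HasSurjectiveModNGaloisRep 3) (hN : W'.conductorNorm ℤ = N') (hK : IsImaginaryQuadratic K)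
    (hH : SatisfiesHeegnerHypothesis N' K) (hodd : Odd (NumberField.discr K))
    (κ : ZpExtension K 3) (hκ : κ.IsAnticyclotomic)
    (γ : absoluteGaloisGroup K) [hγ : Fact (κ.IsTopGenerator γ)]
    (𝔭 : HeightOneSpectrum (𝓞 K)) (h𝔭 : ((3 : ℕ) : 𝓞 K) ∈ 𝔭.asIdeal)
    (he : 𝔭.asIdeal.ramificationIdx (𝓞 ℚ) = 1) (hf : 𝔭.asIdeal.inertiaDeg (𝓞 ℚ) = 1)
    (𝔭' : HeightOneSpectrum (𝓞 K)) (h𝔭' : ((3 : ℕ) : 𝓞 K) ∈ 𝔭'.asIdeal) (hne : 𝔭' ≠ 𝔭) :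
    Module.IsTorsion (IwasawaAlgebra 3) (XAc (W'.baseChange K) 3 κ 𝔭' ∅ γ) ∧
      ∃ g' : UnrSeries 3,
        (XAc.charIdeal (W'.baseChange K) 3 κ 𝔭' ∅ γ).map (PowerSeries.map (Halves.toUnr 3)) =
            Ideal.span {g'} ∧
          ∃ i : ℕ, ‖((PowerSeries.coeff i g' : unrIntegers 3) : ℂ_[3])‖ = 1 := by
  -- K1: an admissible family with a locally indivisible layer
  obtain ⟨jbar, F, hc, hK1⟩ :=
    stub_locNondivisible W' N' K hm htr hsurj hN hK hH hodd κ hκ 𝔭 h𝔭 he hf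
  -- the Λ-adic data exist (tree theorems)
  obtain ⟨D⟩ := LambdaAdicSelmerDataExists.nonempty_lambdaAdicSelmerData (W'.baseChange K) 3 κ hγ.out
  obtain ⟨X⟩ := (W'.baseChange K).nonempty_selmerDualData_holds (κ := κ) γ hγ.out
  -- K2: Howard's divisibility and the rank data
  obtain ⟨⟨hSfin, hStf, hS1⟩, hXfin, hX1, hHow⟩ :=
    stub_howardTwoSidedAtThree W' N' K hm htr hsurj hN hK hH hodd κ hκ γ jbar D F X
  haveI := hSfin; haveI := hStf; haveI := hXfin
  haveI : Module.Finite (IwasawaAlgebra 3) (XAc (W'.baseChange K) 3 κ 𝔭' ∅ γ) :=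
    XAc.module_finite_empty κ 𝔭' γ
  -- the print-port package, then the landed algebra in one step
  obtain ⟨κinf, loc, hκH, hpkg, hbridge⟩ :=
    stub_ptPackage W' N' K hm htr hsurj hN hK hH hodd κ hκ γ 𝔭 h𝔭 he hf 𝔭' h𝔭' hne jbar D F X hc
      hSfin hStf hS1 hXfin hX1
  exact isTorsion_and_exists_generator_of_package' hS1 κinf (heegnerModule D F) hκH loc hpkg hHow (hbridge hK1)

/-- Bucket C₀ of R2 from the three signed stubs and the landed two-sided Λ-algebra (same package theorem). -/
theorem twinAlgMu_goodSS
    (W' : WeierstrassCurve ℚ) [W'.IsElliptic] [W'.IsGloballyMinimal] (N' : ℕ) [NeZero N']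
    (K : Type) [Field K] [NumberField K]
    (hss : Rank1Residual.GoodSS W' 3) (ha : W'.frobeniusTrace 3 = 0)
    (hsurj : W'.HasSurjectiveModNGaloisRep 3) (hN : W'.conductorNorm ℤ = N') (hK : IsImaginaryQuadratic K)
    (hH : SatisfiesHeegnerHypothesis N' K) (hodd : Odd (NumberField.discr K))
    (κ : ZpExtension K 3) (hκ : κ.IsAnticyclotomic)
    (γ : absoluteGaloisGroup K) [hγ : Fact (κ.IsTopGenerator γ)]
    (𝔭 : HeightOneSpectrum (𝓞 K)) (h𝔭 : ((3 : ℕ) : 𝓞 K) ∈ 𝔭.asIdeal)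
    (he : 𝔭.asIdeal.ramificationIdx (𝓞 ℚ) = 1) (hf : 𝔭.asIdeal.inertiaDeg (𝓞 ℚ) = 1)
    (𝔭' : HeightOneSpectrum (𝓞 K)) (h𝔭' : ((3 : ℕ) : 𝓞 K) ∈ 𝔭'.asIdeal) (hne : 𝔭' ≠ 𝔭) :
    Module.IsTorsion (IwasawaAlgebra 3) (XAc (W'.baseChange K) 3 κ 𝔭' ∅ γ) ∧
      ∃ g' : UnrSeries 3,
        (XAc.charIdeal (W'.baseChange K) 3 κ 𝔭' ∅ γ).map (PowerSeries.map (Halves.toUnr 3)) =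
            Ideal.span {g'} ∧
          ∃ i : ℕ, ‖((PowerSeries.coeff i g' : unrIntegers 3) : ℂ_[3])‖ = 1 := by
  obtain ⟨jbar, F, ε, hc, htr, hK1⟩ :=
    stub_signedLocNondivisible W' N' K hss ha hsurj hN hK hH hodd κ hκ 𝔭 h𝔭 he hf
  obtain ⟨z, hz, htf, loc, hpkg, hbridge⟩ :=
    stub_signedPackage W' N' K hss ha hsurj hN hK hH hodd κ hκ γ 𝔭 h𝔭 he hf 𝔭' h𝔭' hne jbar F ε hc htr
  obtain ⟨⟨hSfin, hS1⟩, ⟨hXfin, hX1⟩, hHow⟩ :=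
    stub_signedHoward W' N' K hss ha hsurj hN hK hH hodd κ hκ γ jbar F htr ε z hz
  letI := selmerLambdaAdic.moduleOfGen (W'.baseChange K) 3 κ γ hγ.out (fun _ ↦ PCond.sgn ε)
  letI := AcSigned.X.moduleOfGen (W'.baseChange K) 3 κ ∅ (fun _ ↦ PCond.sgn ε) hγ.out
  haveI := hSfin; haveI := htf; haveI := hXfin
  haveI : Module.Finite (IwasawaAlgebra 3) (XAc (W'.baseChange K) 3 κ 𝔭' ∅ γ) :=
    XAc.module_finite_empty κ 𝔭' γ
  exact isTorsion_and_exists_generator_of_package' hS1 z (Submodule.span (IwasawaAlgebra 3) {z})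
    (Submodule.mem_span_singleton_self z) loc (hpkg hSfin hS1 hXfin) hHow (hbridge hK1)

/-- **The composition**: bucket split of R2; B from the three B-stubs, C₀ from the three signed stubs, both through the landed algebra.
Concludes the crux BY NAME. -/
theorem TwinAlgMuZeroAtThree_of :
    Summit.BirchSwinnertonDyer.BirchSwinnertonDyer.Theses.UniversalToricDescent.TwinAlgMuZeroAtThree := by
  intro W' _ _ N' _ K _ _ Dt' hbucket hsurj hN hK hH hodd κ hκ γ _ 𝔭 h𝔭 he hf 𝔭' h𝔭' hne
  rcases hbucket with ⟨hm, htr⟩ | ⟨hss, ha⟩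
  · exact twinAlgMu_mult W' N' K hm htr hsurj hN hK hH hodd κ hκ γ 𝔭 h𝔭 he hf 𝔭' h𝔭' hne
  · exact twinAlgMu_goodSS W' N' K hss ha hsurj hN hK hH hodd κ hκ γ 𝔭 h𝔭 he hf 𝔭' h𝔭' hne

end Summit.BirchSwinnertonDyer.BirchSwinnertonDyer.Cruxes.TwinAlgMuZeroAtThree.Birth

end
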